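import Mathlib
import Summits.MatrixMultiplication.MatrixMultiplication.Theorems.GradedDesignFamily.Negative.CuspFormWall
import Literature.NumberTheory.GaloisRepresentations.SL2WreathResidualImage

/-!
# The cusp-form wall of the subfield cell `GL₂(𝔽₉) ⊃ SL₂(𝔽₃)`: `|Y| + |Z| ≤ 21`
# (crux `LevelGradedCohnUmans.GradedDesignFamily`, stmt-MatrixMultiplication-7610; negative side,
# line `quadratic-extension-level-one-cell`, finite cell `q = 3` of stub S3 `stub_subfieldCell`)

HONEST FRAMING (B2b-5 subfield cell, generation 4).  This is a THEOREM ABOUT A DECIDED FINITE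
CELL, not summit progress: for every level-one separated triple `(φ(SL₂ k), Y, Z)` in `GL₂(K)`
with `|k| = 3`, `|K| = 9` (S3's clause verbatim) we prove `|Y| + |Z| ≤ 21`, hence the design
volume `|SL₂(𝔽₃)|·|Y|·|Z| = 24·|Y|·|Z| ≤ 24·110 = 2640` (the explicit ceiling of
`SubfieldCellNineCubes` gave `|Y| + |Z| ≤ 35`, volume `≤ 7350`).  In particular
`min(|Y|,|Z|) ≤ 10`.  The largest designs known in this cell are `(|Y|,|Z|) = (4,6)` and `(5,4)`
(kernel-checked instance `(4,6)`: `…StubSubfieldCellNineWitness`).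

PROOF.  `CuspFormWall.cuspFormWall` with the cusp form `e = 2·𝟙_{Q₈} − 𝟙_{SL₂(𝔽₃) ∖ Q₈}`
(`= λ + λ̄`, the two non-trivial linear characters of `SL₂(𝔽₃) = Q₈ ⋊ C₃`), written
intrinsically as `e(h) = 2` if `h⁴ = 1` and `−1` otherwise.  Cuspidality — every coset of every
root subgroup `b U b⁻¹ ≅ C₃` contains exactly one element of `Q₈ = {h : h⁴ = 1}` — is the
decidable fact `sl2_zmod_three_rootCoset_sum` over `ZMod 3` (`native_decide`), transported to an
arbitrary field `k` with three elements along `ZMod.ringEquivOfPrime`.  (At `q = 3` the trace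
forms of `CuspFormTrace` all vanish, since `a + a⁻¹ ∈ {−1, 1} = 𝔽₃ˣ… covers every non-zero trace
class; the quaternion form is the whole `2`-dimensional cusp space's rational line.)

VALUE = theorem / certificate for the finite cell `q = 3`; the asymptotic stub `stub_subfieldCell`
and the crux are untouched.
-/

set_option linter.dupNamespace false

open scoped BigOperators

namespace Summit.MatrixMultiplication.MatrixMultiplication.Theorems.GradedDesignFamily.Negative

/-- Over `ZMod 3`: on every coset `g · (b U b⁻¹)` of every root subgroup of `SL₂(𝔽₃)` the form
`h ↦ (2 if h⁴ = 1 else −1)` sums to zero (each such coset meets `Q₈ = {h : h⁴ = 1}` exactly once).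
Decided by `native_decide` (576 cosets). -/
theorem sl2_zmod_three_rootCoset_sum :
    ∀ g b : Matrix.SpecialLinearGroup (Fin 2) (ZMod 3),
      (∑ x : ZMod 3, if (g * b * ⟨!![(1 : ZMod 3), x; 0, 1], sl2md_det_upper x⟩ * b⁻¹) ^ 4 = 1
        then (2 : ℤ) else -1) = 0 := by
  native_decide

/-- **The cusp-form wall at `q = 3`.**  For fields `k ⊂ K` with `|k| = 3`, `|K| = |k|²`, an
injective hom `φ : SL₂(k) →* GL₂(K)` and nonempty `Y, Z ⊆ GL₂(K)` level-one separated against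
`φ(SL₂ k)` (S3's clause verbatim): `|Y| + |Z| ≤ (|K| + 1)(|k| − 1) + 1 = 21`.
Finite-cell theorem, not summit progress. -/
theorem subfieldCell_nine_wall {k K : Type} [Field k] [Fintype k] [DecidableEq k] [Field K]
    [Fintype K] [DecidableEq K] (hk : Fintype.card k = 3)
    (φ : Matrix.SpecialLinearGroup (Fin 2) k →* Matrix.GeneralLinearGroup (Fin 2) K)
    (hφ : Function.Injective φ) (hK : Fintype.card K = Fintype.card k ^ 2)
    (Y Z : Finset (Matrix.GeneralLinearGroup (Fin 2) K)) (hY : Y.Nonempty) (hZ : Z.Nonempty)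
    (hsep : ∀ z₀ ∈ Z, ∃ cf : (Fin 2 → K) → (Fin 2 → K) → ℂ,
      ∀ a : Matrix.SpecialLinearGroup (Fin 2) k, ∀ y ∈ Y, ∀ y' ∈ Y, ∀ z ∈ Z,
        (∑ u : Fin 2 → K, cf u (((φ a * y * y'⁻¹ * z : Matrix.GeneralLinearGroup (Fin 2) K) :
            Matrix (Fin 2) (Fin 2) K).mulVec u)) =
          if a = 1 ∧ y = y' ∧ z = z₀ then 1 else 0) :
    Y.card + Z.card ≤ 21 := by
  have h3 : Nat.Prime 3 := by norm_num
  -- transport `ZMod 3 ≃+* k` and the induced isomorphism of `SL₂`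
  let ι : ZMod 3 ≃+* k := ZMod.ringEquivOfPrime k h3 hk
  let F : Matrix.SpecialLinearGroup (Fin 2) (ZMod 3) →* Matrix.SpecialLinearGroup (Fin 2) k :=
    Matrix.SpecialLinearGroup.map ι.toRingHom
  have hFcoe : ∀ a : Matrix.SpecialLinearGroup (Fin 2) (ZMod 3), ∀ i j,
      (F a : Matrix (Fin 2) (Fin 2) k) i j = ι ((a : Matrix (Fin 2) (Fin 2) (ZMod 3)) i j) := by
    intro a i j
    rfl
  have hFinj : Function.Injective F := by
    intro a b hab
    ext i j
    have h := congrArg (fun m : Matrix.SpecialLinearGroup (Fin 2) k =>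
      (m : Matrix (Fin 2) (Fin 2) k) i j) hab
    simp only [hFcoe] at h
    exact ι.injective h
  have hFsurj : Function.Surjective F := by
    intro g
    refine ⟨Matrix.SpecialLinearGroup.map ι.symm.toRingHom g, ?_⟩
    ext i j
    rw [hFcoe]
    exact ι.apply_symm_apply _
  -- the quaternion cusp form, intrinsically
  let e : Matrix.SpecialLinearGroup (Fin 2) k → ℂ := fun h => if h ^ 4 = 1 then 2 else -1
  have he : ∃ a, e a ≠ 0 := ⟨1, by simp [e]⟩
  have hcusp : ∀ g b : Matrix.SpecialLinearGroup (Fin 2) k,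
      ∑ x : k, e (g * b * ⟨!![(1 : k), x; 0, 1], sl2md_det_upper x⟩ * b⁻¹) = 0 := by
    intro g b
    obtain ⟨g₀, rfl⟩ := hFsurj g
    obtain ⟨b₀, rfl⟩ := hFsurj b
    have hU : ∀ x₀ : ZMod 3, (⟨!![(1 : k), ι x₀; 0, 1], sl2md_det_upper (ι x₀)⟩ :
        Matrix.SpecialLinearGroup (Fin 2) k) = F ⟨!![(1 : ZMod 3), x₀; 0, 1], sl2md_det_upper x₀⟩ := by
      intro x₀
      ext i j
      rw [hFcoe]
      fin_cases i <;> fin_cases j <;> simp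
    -- reindex the sum along `ι`
    rw [← Equiv.sum_comp ι.toEquiv]
    have hsummand : ∀ x₀ : ZMod 3,
        e (F g₀ * F b₀ * ⟨!![(1 : k), ι.toEquiv x₀; 0, 1], sl2md_det_upper (ι.toEquiv x₀)⟩ * (F b₀)⁻¹) =
          ((if (g₀ * b₀ * ⟨!![(1 : ZMod 3), x₀; 0, 1], sl2md_det_upper x₀⟩ * b₀⁻¹) ^ 4 = 1
            then (2 : ℤ) else -1 : ℤ) : ℂ) := by
      intro x₀
      have hι : ι.toEquiv x₀ = ι x₀ := rfl
      rw [hι, hU]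
      have hiff : (F (g₀ * b₀ * ⟨!![(1 : ZMod 3), x₀; 0, 1], sl2md_det_upper x₀⟩ * b₀⁻¹)) ^ 4 = 1 ↔
          (g₀ * b₀ * ⟨!![(1 : ZMod 3), x₀; 0, 1], sl2md_det_upper x₀⟩ * b₀⁻¹) ^ 4 = 1 := by
        rw [← map_pow, ← map_one F]
        exact hFinj.eq_iff
      dsimp only [e]
      by_cases hP : (g₀ * b₀ * ⟨!![(1 : ZMod 3), x₀; 0, 1], sl2md_det_upper x₀⟩ * b₀⁻¹) ^ 4 = 1
      · have hP' : (F g₀ * F b₀ * F ⟨!![(1 : ZMod 3), x₀; 0, 1], sl2md_det_upper x₀⟩ * (F b₀)⁻¹) ^ 4 = 1 := by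
          rw [← map_inv, ← map_mul, ← map_mul, ← map_mul]
          exact hiff.2 hP
        rw [if_pos hP', if_pos hP]
        push_cast
        rfl
      · have hP' : ¬ (F g₀ * F b₀ * F ⟨!![(1 : ZMod 3), x₀; 0, 1], sl2md_det_upper x₀⟩ * (F b₀)⁻¹) ^ 4 = 1 := by
          rw [← map_inv, ← map_mul, ← map_mul, ← map_mul]
          exact fun h => hP (hiff.1 h)
        rw [if_neg hP', if_neg hP]
        push_cast
        rfl
    rw [Finset.sum_congr rfl (fun x₀ _ => hsummand x₀), ← Int.cast_sum,
      sl2_zmod_three_rootCoset_sum g₀ b₀, Int.cast_zero]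
  have wall := cuspFormWall φ hφ hK Y Z hY hZ hsep e he hcusp
  rw [hK, hk] at wall
  norm_num at wall
  exact wall

/-- **Volume form of the `q = 3` cusp-form wall**: design volume
`|SL₂(k)|·|Y|·|Z| ≤ 24 · 110 = 2640` (from `|Y| + |Z| ≤ 21`).  Finite-cell theorem,
not summit progress. -/
theorem subfieldCell_nine_volume_le_cusp {k K : Type} [Field k] [Fintype k] [DecidableEq k]
    [Field K] [Fintype K] [DecidableEq K] (hk : Fintype.card k = 3)
    (φ : Matrix.SpecialLinearGroup (Fin 2) k →* Matrix.GeneralLinearGroup (Fin 2) K)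
    (hφ : Function.Injective φ) (hK : Fintype.card K = Fintype.card k ^ 2)
    (Y Z : Finset (Matrix.GeneralLinearGroup (Fin 2) K)) (hY : Y.Nonempty) (hZ : Z.Nonempty)
    (hsep : ∀ z₀ ∈ Z, ∃ cf : (Fin 2 → K) → (Fin 2 → K) → ℂ,
      ∀ a : Matrix.SpecialLinearGroup (Fin 2) k, ∀ y ∈ Y, ∀ y' ∈ Y, ∀ z ∈ Z,
        (∑ u : Fin 2 → K, cf u (((φ a * y * y'⁻¹ * z : Matrix.GeneralLinearGroup (Fin 2) K) :
            Matrix (Fin 2) (Fin 2) K).mulVec u)) =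
          if a = 1 ∧ y = y' ∧ z = z₀ then 1 else 0) :
    Nat.card (Matrix.SpecialLinearGroup (Fin 2) k) * Y.card * Z.card ≤ 2640 := by
  have hab := subfieldCell_nine_wall hk φ hφ hK Y Z hY hZ hsep
  have hcard : Nat.card (Matrix.SpecialLinearGroup (Fin 2) k) = 24 := by
    rw [Literature.NumberTheory.GaloisRepresentations.SL2Wreath.natCard_specialLinearGroup_fin_two,
      hk]; norm_num
  rw [hcard]
  have hprod : 4 * (Y.card * Z.card) ≤ (Y.card + Z.card) * (Y.card + Z.card) := by
    nlinarith [Nat.zero_le (Y.card), Nat.zero_le (Z.card), sq_nonneg ((Y.card : ℤ) - Z.card)]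
  have h21 : (Y.card + Z.card) * (Y.card + Z.card) ≤ 21 * 21 := Nat.mul_le_mul hab hab
  have : Y.card * Z.card ≤ 110 := by omega
  calc 24 * Y.card * Z.card = 24 * (Y.card * Z.card) := by ring
    _ ≤ 24 * 110 := Nat.mul_le_mul_left _ this
    _ ≤ 2640 := by norm_num

/-- **`min(|Y|,|Z|) ≤ 10` in the `q = 3` subfield cell** (so the cell's exponent-`ω` proxy
`M_full(3) ≤ 10`; the best known is `4`).  Finite-cell theorem, not summit progress. -/
theorem subfieldCell_nine_min_le {k K : Type} [Field k] [Fintype k] [DecidableEq k]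
    [Field K] [Fintype K] [DecidableEq K] (hk : Fintype.card k = 3)
    (φ : Matrix.SpecialLinearGroup (Fin 2) k →* Matrix.GeneralLinearGroup (Fin 2) K)
    (hφ : Function.Injective φ) (hK : Fintype.card K = Fintype.card k ^ 2)
    (Y Z : Finset (Matrix.GeneralLinearGroup (Fin 2) K)) (hY : Y.Nonempty) (hZ : Z.Nonempty)
    (hsep : ∀ z₀ ∈ Z, ∃ cf : (Fin 2 → K) → (Fin 2 → K) → ℂ,
      ∀ a : Matrix.SpecialLinearGroup (Fin 2) k, ∀ y ∈ Y, ∀ y' ∈ Y, ∀ z ∈ Z,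
        (∑ u : Fin 2 → K, cf u (((φ a * y * y'⁻¹ * z : Matrix.GeneralLinearGroup (Fin 2) K) :
            Matrix (Fin 2) (Fin 2) K).mulVec u)) =
          if a = 1 ∧ y = y' ∧ z = z₀ then 1 else 0) :
    min Y.card Z.card ≤ 10 := by
  have hab := subfieldCell_nine_wall hk φ hφ hK Y Z hY hZ hsep
  omega

end Summit.MatrixMultiplication.MatrixMultiplication.Theorems.GradedDesignFamily.Negative
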